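import Mathlib

/-!
# B3♭-RCFRAME — kernel companion (hsemireg-monad-4 g20; MECH pen + typing)

Bookkeeping for memo `B3FLAT-RCFRAME-monad4-g20.md`: the first-order (Bloch) frame of the
R-C road `Z(s) = D_a(φ)`, `φ = (i, s̃) : F := A ⊕ 𝒪(−tH) → K := ker q`, of a display
`A →i N →q C` on the abelian 8-fold `X`.

* `bottNonzero` — Bott's non-vanishing pattern for `H^q(ℙⁿ, Ω^p(k))`, as a NAMED SPEC
  (a transcription used as a hypothesis-shape, not a claim proved here);
* `tangent_window` — `T_{ℙⁿ}(−r) = Ω^{n−1}(n+1−r)` has fibre cohomology only in the window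
  `r ≤ 1` (q = 0), `r = n+1` (q = n−1), `r ≥ n+3` (q = n): pure arithmetic from the spec;
* `leakWindowPF` / `leakWindowPA` / `leakDegreesPF` / `leakDegreesPA` — the Koszul leak terms
  `H^{r+1}(ℙ, π^*Λ^r K^∨ ⊗ T_{ℙ/X}(−r))`, `1 ≤ r ≤ a+4`, that survive the window, for
  `Z̃ ⊂ ℙ(F)` (fibre dimension `n = a`) and `Σ̃ ⊂ ℙ(A)` (`n = a−1`), and the degrees on `X`
  in which they land (LEMMA LEAK of the memo);
* `gr_window` / `gr_window_one` / `gr_window_top` / `gr_xdeg` / `grBott` — the Grassmannian window of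
  LEMMA LEAK-Gr (relative Borel–Weil–Bott on `Gr_a(K)`; machine list `g20/code/gr_leak_bbw.py`);
* `dims` — dimension bookkeeping of RC-P; `scalar_pinned` — the block identity behind THEOREM RC-F;
* `Letter.index`, `Cell.index`, `I2flat`, `HLadder` — the decidable letter predicates of the
  (I2♭) table (`g20/code/b3flat_leak.py`): Mumford index on `S = E_i × E_i`, Gram `diag(2,−2,−2)`,
  Künneth additivity of the index for non-degenerate boxes.
* `structure_window` / `g_higher_terms` / `t_higher_terms` / `graded_dim` / `budget5` / `b3flat_dim` —
  the bookkeeping of LEMMA RC-E (memo §5.1, v1.2): the sheaf-side groups `h^j(Z̃, T_{ℙ(F)/X}|) =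
  ext^{j+1}(𝓔, A)`, `h^j(Z̃, N_{Z̃/ℙ(F)}) = ext^{j+1}(𝓔, K)` (`j = 1, 2`, `t ≫ 0`) and the necessary
  budget (B3♭-dim) `ext²(𝓔,K) ≤ 3136 + ext²(𝓔,A)`; `corr36` / `two_rows` — PROPOSITION RC-E♮ (§5.2, v1.3).

Nothing in this file is a statement about HC, HC_CM, HC_AV, H2 = `BlochSeedDiscOne`,
stmt-18881 or stmt-26512; no census word; Mathlib only; no `sorry`.
-/

set_option linter.dupNamespace false
set_option autoImplicit false

namespace Summit.HodgeConjecture.HodgeConjecture.Cruxes.BlochSeedDiscOne.RCFrame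

/-! ## Bott window for the twisted relative tangent bundle -/

/-- SPEC (Bott's formula, `0 ≤ p ≤ n`): `H^q(ℙⁿ, Ω^p(k)) ≠ 0` iff
`(q = 0 ∧ k > p) ∨ (k = 0 ∧ q = p) ∨ (q = n ∧ k < p − n)`. -/
def bottNonzero (n p q : ℕ) (k : ℤ) : Prop :=
  (q = 0 ∧ (p : ℤ) < k) ∨ (k = 0 ∧ q = p) ∨ (q = n ∧ k < (p : ℤ) - n)

/-- `T_{ℙⁿ}(−r) = Ω^{n−1}(n+1−r)`: the spec leaves fibre cohomology only for
`r ≤ 1` (degree 0), `r = n+1` (degree `n−1`), `r ≥ n+3` (degree `n`). -/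
theorem tangent_window (n r q : ℕ) (hn : 1 ≤ n) :
    bottNonzero n (n - 1) q ((n : ℤ) + 1 - r) ↔
      ((q = 0 ∧ r ≤ 1) ∨ (q = n - 1 ∧ r = n + 1) ∨ (q = n ∧ n + 3 ≤ r)) := by
  unfold bottNonzero
  omega

/-- The surviving window as a predicate on `(n, r, j)`: `R^jπ_*(T_{ℙ/X}(−r)) ≠ 0` only if `survives n r j`. -/
def survives (n r j : ℕ) : Prop :=
  (j = 0 ∧ r ≤ 1) ∨ (j = n - 1 ∧ r = n + 1) ∨ (j = n ∧ n + 3 ≤ r)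

theorem survives_iff_bott (n r j : ℕ) (hn : 1 ≤ n) :
    survives n r j ↔ bottNonzero n (n - 1) j ((n : ℤ) + 1 - r) := by
  rw [tangent_window n r j hn]
  rfl

/-- `Z̃ ⊂ ℙ(F)`, fibre dimension `n = a ≥ 1`, Koszul range `1 ≤ r ≤ a + 4 = rk K`:
the surviving leak terms are `r = 1` (j = 0), `r = a+1` (j = a−1), `r ∈ {a+3, a+4}` (j = a). -/
theorem leakWindowPF (a r j : ℕ) (ha : 1 ≤ a) (hr : 1 ≤ r) (hr' : r ≤ a + 4) :
    survives a r j ↔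
      ((r = 1 ∧ j = 0) ∨ (r = a + 1 ∧ j = a - 1) ∨ ((r = a + 3 ∨ r = a + 4) ∧ j = a)) := by
  unfold survives
  omega

/-- `Σ̃ ⊂ ℙ(A)` (and the restriction to `Ẑ`), fibre dimension `n = a − 1`, `a ≥ 2`, `1 ≤ r ≤ a + 4`:
surviving terms `r = 1` (j = 0), `r = a` (j = a−2), `r ∈ {a+2, a+3, a+4}` (j = a−1). -/
theorem leakWindowPA (a r j : ℕ) (ha : 2 ≤ a) (hr : 1 ≤ r) (hr' : r ≤ a + 4) :
    survives (a - 1) r j ↔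
      ((r = 1 ∧ j = 0) ∨ (r = a ∧ j = a - 2) ∨ ((r = a + 2 ∨ r = a + 3 ∨ r = a + 4) ∧ j = a - 1)) := by
  unfold survives
  omega

/-- On `X` the surviving `ℙ(F)` leak terms land in degrees `r + 1 − j ∈ {2, 3, 4, 5}`
(`Ext²(K,F)`, `H³(Λ^{a+1}K^∨ ⊗ det F)`, `H⁴`, `H⁵`); all but the first carry `−t`. -/
theorem leakDegreesPF (a r j : ℕ) (ha : 1 ≤ a) (hr : 1 ≤ r) (hr' : r ≤ a + 4)
    (h : survives a r j) : r + 1 - j = 2 ∨ r + 1 - j = 3 ∨ r + 1 - j = 4 ∨ r + 1 - j = 5 := by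
  rw [leakWindowPF a r j ha hr hr'] at h
  omega

/-- On `X` the surviving `ℙ(A)` leak terms land in degrees `r + 1 − j ∈ {2, 3, 4, 5, 6}`
(`Ext²(K,A)`, `H³(Λ^aK^∨ ⊗ det A)`, `H⁴(Λ^{a+2}K^∨ ⊗ Λ²A ⊗ det A)`, `H⁵`, `H⁶`); all `t`-free. -/
theorem leakDegreesPA (a r j : ℕ) (ha : 2 ≤ a) (hr : 1 ≤ r) (hr' : r ≤ a + 4)
    (h : survives (a - 1) r j) :
    r + 1 - j = 2 ∨ r + 1 - j = 3 ∨ r + 1 - j = 4 ∨ r + 1 - j = 5 ∨ r + 1 - j = 6 := by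
  rw [leakWindowPA a r j ha hr hr'] at h
  omega

/-- The only `t`-free `ℙ(F)` term is `r = 1`: every surviving term with `r ≥ 2` has `j ≥ a − 1 ≥ 0` and
(memo, Littlewood–Richardson) `t`-exponent `−(m+1) ≤ −1`; here only the window fact `r ≥ 2 → j + 2 ≥ a + 1`. -/
theorem pf_higher_terms (a r j : ℕ) (ha : 1 ≤ a) (hr : 2 ≤ r) (hr' : r ≤ a + 4)
    (h : survives a r j) : a ≤ j + 1 ∧ a + 1 ≤ r := by
  rw [leakWindowPF a r j ha (by omega) hr'] at h
  omega

/-! ## Dimension bookkeeping of RC-P and the block identity of RC-F -/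

/-- `dim ℙ(F) = 8 + a`, `Z̃` = regular zero scheme of rank `a + 4` ⇒ `dim Z̃ = 4`;
`dim ℙ(A) = 7 + a`, `Σ̃` codim `a + 4` ⇒ `dim 3`; `Ẑ = D₁` of a rank-2 → rank-(a+4) map, codim `a + 3` ⇒ `dim 4`;
`D_a(φ)` codim `4`, `D_{a−1}(i)` codim `5`, `D_{a−2}(i)` codim `12 > 8 = dim X`. -/
theorem dims (a : ℕ) (ha : 2 ≤ a) :
    (8 + a) - (a + 4) = 4 ∧ (7 + a) - (a + 4) = 3 ∧ (7 + a) - (a + 3) = 4 ∧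
    (a + 4 - a) * (a + 1 - a) = 4 ∧ (a + 4 - (a - 1)) * (a - (a - 1)) = 5 ∧
    (a + 4 - (a - 2)) * (a - (a - 2)) = 12 ∧ 8 < 12 := by
  have h1 : a + 4 - a = 4 := by omega
  have h2 : a + 1 - a = 1 := by omega
  have h3 : a + 4 - (a - 1) = 5 := by omega
  have h4 : a - (a - 1) = 1 := by omega
  have h5 : a + 4 - (a - 2) = 6 := by omega
  have h6 : a - (a - 2) = 2 := by omega
  refine ⟨by omega, by omega, by omega, ?_, ?_, ?_, by omega⟩
  · rw [h1, h2]
  · rw [h3, h4]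
  · rw [h5, h6]

/-- `rk K(t) = a + 4 > 8 = dim X` (so a general section of the globally generated `K(t)` is nowhere zero)
as soon as `a ≥ 5`; for `1 ≤ a ≤ 4` the memo uses `s̃` general only through RC-Z. -/
theorem rank_exceeds_dim (a : ℕ) (ha : 5 ≤ a) : 8 < a + 4 := by omega

/-- THEOREM RC-F, block step: with `F = A ⊕ 𝒪(−tH)`, `κ·At(F) = (x, 0; 0, 0)` and
`Ψ∘φ + c·id_F = (y, z; 0, c)` agree modulo nothing once the `𝒪(−tH)`-diagonal block is compared:
it pins `c = 0`, whence `x = y` on the `A`-block. Abstract form over a module. -/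
theorem scalar_pinned {R V : Type*} [Ring R] [AddCommGroup V] [Module R V]
    (x y u : V) (c : R) (hAA : x = y + c • u) (hOO : (0 : R) = 0 + c) : c = 0 ∧ x = y := by
  have hc : c = 0 := by simpa using hOO.symm
  refine ⟨hc, ?_⟩
  simpa [hc] using hAA

/-- If moreover the `A`-block class `y = Ψ ∘ i` ranges over the image of a linear map `compI`
(composition with `i`, `Ext²(K,A) → Ext²(A,A)`), RC-F reads: `x ∈ range compI`. -/
theorem rcF_shape {R V W : Type*} [Ring R] [AddCommGroup V] [Module R V] [AddCommGroup W] [Module R W]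
    (compI : W →ₗ[R] V) (x u : V) (Ψ : W) (c : R)
    (hAA : x = compI Ψ + c • u) (hOO : (0 : R) = 0 + c) : x ∈ LinearMap.range compI := by
  obtain ⟨-, hx⟩ := scalar_pinned x (compI Ψ) u c hAA hOO
  exact ⟨Ψ, hx.symm⟩

/-! ## Grassmannian window (LEMMA LEAK-Gr: the model `Z_Gr ⊂ Gr_a(K)`)

Relative Borel–Weil–Bott on `Gr_a(K) → X` (`rk K = n = a + 4`, tautological `U` of rank `a`, quotient `𝒬` of
rank 4; bundle `𝕊_α 𝒬 ⊗ 𝕊_β U` ↔ weight `γ = (α | β)`, `ρ = (n, n−1, …, 1)`): `γ + ρ` with a repeated entry ⇒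
`Rρ_* = 0`; else `ℓ` = number of inversions and `R^ℓ ρ_* = 𝕊_{sort(γ+ρ) − ρ} K`. The Koszul term of rank `r`
for `Z_Gr` contributes `𝕊_λ F ⊗ [𝕊_{λ'}𝒬^∨ ⊗ 𝒬 ⊗ U^∨]`, `|λ| = r`, `λ₁ ≤ 4`, `ℓ(λ) ≤ a + 1`, and the bracket
has weight `γ = (α | 0^{a−1}, −1)`, `α_i = −μ_i + [i = i₀]`, `μ = (λ'_4, λ'_3, λ'_2, λ'_1)`. The `𝒬`-block entries
of `γ + ρ` are `q_i = a + 5 − i − μ_i + [i = i₀]`, the `U`-block entries are `{a, …, 2} ∪ {0}`. -/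

/-- Window: `q_i` avoids the `U`-block `{0} ∪ [2, a]` iff `q_i ≥ a + 1` or `q_i = 1`
(the alternative `q_i ≤ −1` cannot occur because `μ_i ≤ ℓ(λ) ≤ a + 1`). -/
theorem gr_window (a i μ b : ℕ) (hi : 1 ≤ i ∧ i ≤ 4) (hμ : μ ≤ a + 1) (hb : b ≤ 1) :
    (((a : ℤ) + 5 - i - μ + b ≠ 0 ∧ ¬ (2 ≤ (a : ℤ) + 5 - i - μ + b ∧ (a : ℤ) + 5 - i - μ + b ≤ a))
      ↔ ((a : ℤ) + 1 ≤ (a : ℤ) + 5 - i - μ + b ∨ (a : ℤ) + 5 - i - μ + b = 1)) := by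
  omega

/-- The slot `q_i = 1` (which costs `a − 1` inversions) occurs only for `i ≥ 3`, with `μ_i ≥ a`
(so `λ'_1 ≥ a`: the shape `λ` has at least `a` rows, `r = |λ| ≥ a`). -/
theorem gr_window_one (a i μ b : ℕ) (hi : 1 ≤ i ∧ i ≤ 4) (hμ : μ ≤ a + 1) (hb : b ≤ 1)
    (h : (a : ℤ) + 5 - i - μ + b = 1) : 3 ≤ i ∧ a ≤ μ := by
  omega

/-- The slot `q_i ≥ a + 1` (no inversions) forces `μ_i ≤ 4 − i + [i = i₀]` (a corner of the 4 × 4 box). -/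
theorem gr_window_top (a i μ b : ℕ)
    (h : (a : ℤ) + 1 ≤ (a : ℤ) + 5 - i - μ + b) : μ + i ≤ 4 + b := by
  omega

/-- Degree bookkeeping: a surviving term with `r = a + s` boxes (`0 ≤ s ≤ 4`) and `ℓ = a − 1` inversions lands in
`H^{r+1−ℓ}(X, ·) = H^{s+2}(X, ·)`, degrees `2 … 6 < 8 = dim X` — so every `𝒪(−mtH)`-twisted companion
(`m ≥ 1`) dies for `t ≫ 0` by Serre vanishing + duality, exactly as on `ℙ(F)`. -/
theorem gr_xdeg (a s : ℕ) (ha : 1 ≤ a) (hs : s ≤ 4) :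
    (a + s) + 1 - (a - 1) = s + 2 ∧ s + 2 < 8 := by
  omega

/-- Computable Bott step on a weight (list of integers, length `n`): `none` if `γ + ρ` has a repeated
entry, else `(ℓ, sort(γ+ρ) − ρ)`. Insertion sort (structural recursion) so that `decide` evaluates it. -/
def insertDesc (x : ℤ) : List ℤ → List ℤ
  | [] => [x]
  | y :: ys => if y < x then x :: y :: ys else y :: insertDesc x ys

def sortDesc : List ℤ → List ℤ
  | [] => []
  | x :: xs => insertDesc x (sortDesc xs)

def inversions : List ℤ → ℕ
  | [] => 0
  | x :: xs => (xs.filter (fun y => x < y)).length + inversions xs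

def hasDup : List ℤ → Bool
  | [] => false
  | x :: xs => xs.contains x || hasDup xs

def rhoList (n : ℕ) : List ℤ := (List.range n).reverse.map (fun k => (k : ℤ) + 1)

def grBott (γ : List ℤ) : Option (ℕ × List ℤ) :=
  let n := γ.length
  let g := List.zipWith (· + ·) γ (rhoList n)
  if hasDup g then none
  else some (inversions g, List.zipWith (· - ·) (sortDesc g) (rhoList n))

/-- Convention checks on `Gr_3(ℂ⁷)`: `𝒬 ↦ H⁰ = V`, `U ↦ 0`, `U^∨ ↦ H⁰ = V^∨`, `T = 𝒬 ⊗ U^∨ ↦ H⁰ = 𝔰𝔩(V)`. -/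
example : grBott [1, 0, 0, 0, 0, 0, 0] = some (0, [1, 0, 0, 0, 0, 0, 0]) ∧
    grBott [0, 0, 0, 0, 1, 0, 0] = none ∧
    grBott [0, 0, 0, 0, 0, 0, -1] = some (0, [0, 0, 0, 0, 0, 0, -1]) ∧
    grBott [1, 0, 0, 0, 0, 0, -1] = some (0, [1, 0, 0, 0, 0, 0, -1]) := by
  decide

/-- `a = 6` (`n = 10`). `r = 1`: the trace part `U^∨` pushes down to `K^∨` in degree 0 (the leak `Ext²(K, F)`),
the traceless part `𝔰𝔩(𝒬) ⊗ U^∨` is Bott-singular (no contribution). -/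
example : grBott [0, 0, 0, 0, 0, 0, 0, 0, 0, -1] = some (0, [0, 0, 0, 0, 0, 0, 0, 0, 0, -1]) ∧
    grBott [1, 0, 0, -1, 0, 0, 0, 0, 0, -1] = none := by
  decide

/-- `a = 6`, `r = a`, `λ = (1^a)`, `i₀ = 1` (`α = (1, 0, 0, −a)`): `ℓ = a − 1 = 5` and
`R^ℓρ_* = 𝕊_{(1,0,0,−1,…,−1)} K = 𝕊_{(2,1,1)}K ⊗ det K^∨`, landing in `H^{a+1−ℓ} = H²(X, det A ⊗ ·)`. -/
example : grBott [1, 0, 0, -6, 0, 0, 0, 0, 0, -1] = some (5, [1, 0, 0, -1, -1, -1, -1, -1, -1, -1]) := by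
  decide

/-- `a = 6`, `r = a + 4`, `λ = (4, 2, 1^{a−2})`, `λ' = (a, 2, 1, 1)`, `μ = (1, 1, 2, a)`, `i₀ = 3`
(`α = (−1, −1, −1, −a)`): `ℓ = 5`, `R^ℓρ_* = det K^∨`, landing in `H⁶(X, 𝕊_{(3,1)}A ⊗ det A ⊗ det K^∨)` —
the same group as the `r = a + 4` term on `ℙ(A)`. -/
example : grBott [-1, -1, -1, -6, 0, 0, 0, 0, 0, -1] = some (5, [-1, -1, -1, -1, -1, -1, -1, -1, -1, -1]) := by
  decide

/-! ## The (I2♭) letter predicate (Mumford index on `S = E_i × E_i`, Künneth) -/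

/-- A letter `[a, x, y] = a·I + x·e + y·f` in the symmetric Néron–Severi lattice of `S = E_i × E_i`
(Gram `diag(2, −2, −2)`). -/
abbrev Letter := ℤ × ℤ × ℤ

/-- `n(a,x,y) = a² − x² − y² = χ(𝒪_S(D))` (Riemann–Roch; `D² = 2n`). -/
def Letter.nval (l : Letter) : ℤ := l.1 ^ 2 - l.2.1 ^ 2 - l.2.2 ^ 2

/-- Mumford index of a NON-DEGENERATE letter: `0` ample (`n > 0, a > 0`), `2` anti-ample (`n > 0, a < 0`),
`1` indefinite (`n < 0`); `none` for degenerate letters (`n = 0`: zero or null classes, labelling-dependent). -/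
def Letter.index (l : Letter) : Option ℕ :=
  if l.nval = 0 then none else if l.nval < 0 then some 1 else if 0 < l.1 then some 0 else some 2

/-- `|χ|` of a non-degenerate letter = the one non-zero `h^q`. -/
def Letter.weight (l : Letter) : ℕ := l.nval.natAbs

def Letter.sub (l m : Letter) : Letter := (l.1 - m.1, l.2.1 - m.2.1, l.2.2 - m.2.2)

/-- H-ladder letter: a multiple of `I` (no `e`, `f` component). -/
def Letter.HLadder (l : Letter) : Prop := l.2.1 = 0 ∧ l.2.2 = 0

/-- A cell = a box of four letters on `X = S₁ × S₂ × S₃ × S₄`. -/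
abbrev Cell := Letter × Letter × Letter × Letter

def Cell.sub (c d : Cell) : Cell :=
  (Letter.sub c.1 d.1, Letter.sub c.2.1 d.2.1, Letter.sub c.2.2.1 d.2.2.1, Letter.sub c.2.2.2 d.2.2.2)

/-- Total index of a box with all four factors non-degenerate (Künneth: the box line bundle has cohomology
in the single degree `Σ_j index_j`, of dimension `Π_j |n_j|`); `none` if some factor is degenerate. -/
def Cell.index (c : Cell) : Option ℕ :=
  match Letter.index c.1, Letter.index c.2.1, Letter.index c.2.2.1, Letter.index c.2.2.2 with
  | some i₁, some i₂, some i₃, some i₄ => some (i₁ + i₂ + i₃ + i₄)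
  | _, _, _, _ => none

def Cell.weight (c : Cell) : ℕ :=
  Letter.weight c.1 * Letter.weight c.2.1 * Letter.weight c.2.2.1 * Letter.weight c.2.2.2

/-- `c₁(cell) ∈ ℚ·H`, `H = Σ_j pr_j^* I_j` (the `T_W`-invariant line, LINE 12 `weilRigid_deg1`):
every factor letter is `[n, 0, 0]` with ONE common `n`. -/
def Cell.HLadder (c : Cell) : Prop :=
  (Letter.HLadder c.1 ∧ Letter.HLadder c.2.1 ∧ Letter.HLadder c.2.2.1 ∧ Letter.HLadder c.2.2.2) ∧
  (c.1.1 = c.2.1.1 ∧ c.2.1.1 = c.2.2.1.1 ∧ c.2.2.1.1 = c.2.2.2.1)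

/-- (I2♭), non-degenerate part (labelling-independent): no `A − N` cell difference of total index `2`
(`Ext²(N,A)`), no `A − C` difference of total index `3` (`Ext³(C,A)`). Sufficient for the `r = 1` leak
`Ext²(K,A)` to vanish when all degenerate differences carry generic `Pic⁰` labels (memo LEMMA INDEX). -/
def I2flat (A N C : List Cell) : Prop :=
  (∀ a ∈ A, ∀ b ∈ N, Cell.index (Cell.sub a b) ≠ some 2) ∧
  (∀ a ∈ A, ∀ c ∈ C, Cell.index (Cell.sub a c) ≠ some 3)

/-- RULE (F♭): when the `r = 1` leak vanishes, THEOREM RC-F forces `κ·At(A) = 0` on `T_W`, i.e. (Weil rigidity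
in degree one, LINE 12 `weilRigid_deg1`) every `A`-letter is an H-ladder. Predicate form. -/
def RuleFflat (A : List Cell) : Prop := ∀ a ∈ A, Cell.HLadder a

/-- The 1840bf64 leak pattern `(amp, amp, indef, indef)` has total index `2`:
e.g. factor differences `[1,0,0], [1,0,0], [0,1,0], [0,1,0]`. -/
example : Cell.index ((1, 0, 0), (1, 0, 0), (0, 1, 0), (0, 1, 0)) = some 2 := by decide

/-- The LINE 14 / LINE 16 non-degenerate `A − N` pattern `(indef, indef, indef, indef)` has total index `4`
(lands in `Ext⁴`, invisible to the `r = 1` leak). -/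
example : Cell.index ((0, 4, 0), (0, 0, -4), (-1, 3, 0), (1, 0, 2)) = some 4 := by decide

/-- An `(amp, indef, indef, indef)` difference has total index `3` (feeds `Ext³`). -/
example : Cell.index ((2, 1, 0), (0, 0, 1), (0, 1, 0), (1, 0, 2)) = some 3 := by decide

/-- A null-ray difference (`[7,−7,0]`, the LINE 14 / LINE 16 step letter) is degenerate: index `none`,
its cohomology is labelling-dependent (b3cohom RULE A). -/
example : Letter.index (7, -7, 0) = none := by decide

/-- `[14,0,0]` is an H-ladder letter, `[7,7,0]` is not; the box `([14,0,0]⁴)` is an H-ladder cell,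
`([14,0,0],[14,0,0],[14,0,0],[13,0,0])` (unequal `a`'s: `c₁ ∉ ℚH`) is not. -/
example : Letter.HLadder (14, 0, 0) ∧ ¬ Letter.HLadder (7, 7, 0) := by
  unfold Letter.HLadder
  decide

example : Cell.HLadder ((14, 0, 0), (14, 0, 0), (14, 0, 0), (14, 0, 0)) ∧
    ¬ Cell.HLadder ((14, 0, 0), (14, 0, 0), (14, 0, 0), (13, 0, 0)) := by
  unfold Cell.HLadder Letter.HLadder
  decide

/-! ## LEMMA RC-E bookkeeping: the `𝒪(1−r)` window for `N_{Z̃/ℙ(F)} = π^*K(1)` and the five-term budget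

Memo §5.1.  `Λ^r G^∨ ⊗ G = π^*(Λ^r K^∨ ⊗ K) ⊗ 𝒪(1−r)`; the kernel checks only the window and the
arithmetic of the budget, not the identifications `E₁^{−1,q} = Ext^q(K,K)`, `d₁ = ∘i` (pen). -/

/-- On `ℙ^a` the sheaf `𝒪(1−r)` (`p = 0` in the Bott spec) has fibre cohomology only for `r ≤ 1`
(degree `0`) or `r ≥ a+2` (degree `a`): the terms `2 ≤ r ≤ a+1` of the `G`-sequence vanish outright. -/
theorem structure_window (a r q : ℕ) (ha : 1 ≤ a) :
    bottNonzero a 0 q (1 - (r : ℤ)) ↔ ((q = 0 ∧ r ≤ 1) ∨ (q = a ∧ a + 2 ≤ r)) := by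
  unfold bottNonzero
  omega

/-- The `t`-twisted terms of the `G`-sequence (`a+2 ≤ r ≤ a+4 = rk G`, fibre degree `a`,
`R^aπ_*𝒪(−a−1−k) = S^kF ⊗ det F`) sit in `X`-degree `r + j − a ≤ 6 < 8 = dim X` for total degree
`j ≤ 2`, so Serre vanishing for `𝒪(−mtH)`, `m ≥ 1`, kills them for `t ≫ 0`. -/
theorem g_higher_terms (a r j : ℕ) (hr : a + 2 ≤ r) (hr' : r ≤ a + 4) (hj : j ≤ 2) :
    r + j - a ≤ 6 ∧ r + j - a < 8 := by
  omega

/-- Same for the `T`-sequence in total degrees `j ≤ 2`: the surviving `r ≥ 2` terms have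
`(r, fibre degree) ∈ {(a+1, a−1), (a+3, a), (a+4, a)}` (`tangent_window`), hence `X`-degree `≤ 6`. -/
theorem t_higher_terms (a r i j : ℕ) (ha : 1 ≤ a) (hj : j ≤ 2)
    (h : (r = a + 1 ∧ i = a - 1) ∨ (a + 3 ≤ r ∧ r ≤ a + 4 ∧ i = a)) :
    r + j - i ≤ 6 := by
  omega

/-- Graded dimension: a space filtered with graded pieces `coker` and `ker` has dimension their sum;
this is how `h^j(Z̃,T|) = ext^{j+1}(𝓔,A)` and `h^j(Z̃,N_{Z̃/ℙ}) = ext^{j+1}(𝓔,K)` are read (both sides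
are extensions with the same two pieces). -/
theorem graded_dim (h c k e : ℕ) (hh : h = c + k) (he : e = c + k) : h = e := by
  omega

/-- Five-term budget: for an exact sequence `U → V → W → X → Y` of finite-dimensional spaces write
`rᵢ` for the rank of the `i`-th arrow; rank–nullity plus exactness give `dim V = r₁ + r₂`,
`dim W = r₂ + r₃`, `dim X = r₃ + r₄`, and `r₁ ≤ dim U`.  Then `dim V − dim U ≤ dim W ≤ dim V + dim X`.
With `U, V, W, X = H¹(Z̃,T|), H¹(Z̃,N_{Z̃/ℙ}), H¹(Z,N_{Z/X}), H²(Z̃,T|)` this is COROLLARY RC-E′. -/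
theorem budget5 (u v w x r₁ r₂ r₃ r₄ : ℕ) (hU : r₁ ≤ u) (hV : v = r₁ + r₂) (hW : w = r₂ + r₃)
    (hX : x = r₃ + r₄) : v - u ≤ w ∧ w ≤ v + x := by
  omega

/-- (B3♭-dim): Bloch-semiregularity of the 4-cycle `Z ⊂ X⁸` needs `π_Z : H¹(Z,N) → H⁵(X,Ω³)` injective,
so `h¹(Z,N) ≤ h^{3,5}(X) = 56·56`; with the lower budget this forces `ext²(𝓔,K) ≤ 3136 + ext²(𝓔,A)`. -/
theorem b3flat_dim (eK2 eA2 h1N : ℕ) (hlow : eK2 - eA2 ≤ h1N) (hsr : h1N ≤ 56 * 56) :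
    eK2 ≤ 3136 + eA2 := by
  omega

/-- `h^{3,5}` of an abelian 8-fold: `C(8,3)·C(8,5) = 3136`. -/
example : Nat.choose 8 3 * Nat.choose 8 5 = 3136 := by decide

/-! ## PROPOSITION RC-E♮ bookkeeping (memo §5.2): `𝓔xt¹_X(𝓜,𝓜) = j_*N`, the `𝓜 ↔ 𝓔` correction -/

/-- `Ext²(𝓜,𝒪(−tH)) → Ext²(𝓔,𝓔) → Ext²(𝓜,𝓜) → Ext³(𝓜,𝒪(−tH))` exact with outer dimensions
`h^{0,7} = 8` and `h^{0,6} = 28` (`t ≫ 0`): writing `r₁`, `r₃` for the ranks of the outer arrows,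
`ext²(𝓜,𝓜) + r₁ = ext²(𝓔,𝓔) + r₃`, hence `|ext²(𝓜,𝓜) − ext²(𝓔,𝓔)| ≤ 36`. -/
theorem corr36 (eE eM r₁ r₃ : ℕ) (h1 : r₁ ≤ 8) (h3 : r₃ ≤ 28) (h : eM + r₁ = eE + r₃) :
    eM ≤ eE + 28 ∧ eE ≤ eM + 8 := by
  omega

/-- The two Hodge numbers used: `h^{0,7} = C(8,7) = 8`, `h^{0,6} = C(8,6) = 28` (abelian 8-fold). -/
example : Nat.choose 8 7 = 8 ∧ Nat.choose 8 6 = 28 := by decide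

/-- Homological dimension one: a sheaf with a two-term locally free resolution has `𝓔xt^q = 0` for
`q ≥ 2`, so the local-to-global spectral sequence has two rows (`q ∈ {0,1}`) and degenerates into the
long exact sequence `H^p(𝓗om) → Ext^p → H^{p−1}(𝓔xt¹) → H^{p+1}(𝓗om) → Ext^{p+1}`; the kernel records
only the row count: total degree `n` receives `(p,q) = (n,0)` and `(n−1,1)`. -/
theorem two_rows (n p q : ℕ) (hq : q ≤ 1) (h : p + q = n) : (p = n ∧ q = 0) ∨ (p + 1 = n ∧ q = 1) := by
  omega

end Summit.HodgeConjecture.HodgeConjecture.Cruxes.BlochSeedDiscOne.RCFrame
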